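import Summits.Ventures.LatticeQCDFlow.Scaling.UnitSurvivalPotential

/-!
HONEST FRAMING: exact (Metropolis-corrected) sampling algorithms for lattice gauge theory; figures
of merit are autocorrelation/cost numbers at stated couplings and volumes; no continuum-physics
claim.

# UnitSurvivalFloor — THE UNIT `m/(t(1−t)ĉ)` IS REAL: `d(n) ≥ (1 − t(1−t)ĉ/m)ⁿ − (K+1)ν(s)` FOR THE IDEALISED
# HOT-ONLY STAR AND EVERY STATE `s`, SO `t_mix(ε) ≥ (m/(t(1−t)ĉ) − 1)·log(1/(ε + (K+1)ν(s)))`; ON A LARGE CONFIGURATION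
# SPACE `t_mix(1/4) ≥ (m/(t(1−t)ĉ) − 1)·log 2`, AT UNIFORM LISTING `t_mix(1/4) ≥ (K/(t(1−t)) − 1)·log 2` — THE UNIT OF
# THE CEILING `⌈((K+t)/(t(1−t)))·log(…)⌉`, WITHOUT ITS LOGARITHM (lean-2 GEN-27, ours)

Venture-side (OURS).  Cell `lqcd-flow` (pub-lqcd), unit `pub-lqcd-lean-2-g27`, 2026-08-27.  Chapter M, the floor side
(`HOME/lean-2/OPEN-MATH-chapterM.md` item 2, first-moment part), file 2.  Setting and potential `Ψ_s` of
`Scaling/UnitSurvivalPotential` (idealised hot-only star: one positive unit-mass law `ν` at every level, hub list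
`e_r = (0, κ_r+1)` with multiplicities `≤ ĉ`, identity maps, swap fraction `t`, hot-only updates with a `ν`-reversible
row-stochastic hot kernel; `P = t·GSw + (1−t)·coordKernel M 0`).

## What is proved

* **`unitSurvival_worstTvDist_ge`** — `d(n) ≥ (1 − t(1−t)ĉ/m)ⁿ − (K+1)ν(s)` (start: `s` planted everywhere; the event
  `{∃ k, z_k = s}` dominates `Ψ_s` and has `π̃`-mass `≤ (K+1)ν(s)`).
* **`unitSurvival_mixingTime_ge`** — `0 < t < 1`, `1 ≤ ĉ ≤ m`, `ν`-reversible hot kernel, `ε`-close at some time: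
  `t_mix(ε) ≥ (m/(t(1−t)ĉ) − 1)·log(1/(ε + (K+1)ν(s)))`.
* **`unitSurvival_mixingTime_ge_quarter_of_card`** — `|S| ≥ 4(K+1)`: `t_mix(1/4) ≥ (m/(t(1−t)ĉ) − 1)·log 2`.
* **`uniformStar_unitSurvival_floor`** — `m = cK`, every multiplicity `≤ c`: `t_mix(1/4) ≥ (K/(t(1−t)) − 1)·log 2`.

Reading (no numerics implied): with `Scaling/HubCollectorLaw` (`(K/t − 1)·log(K/4)`), `Scaling/RefreshBudgetFloor`
(`(K+1)/(2(1−t))`) and the ceiling `⌈((K+t)/(t(1−t)))·log(…)⌉` of `Scaling/DominatedStarRetunedConstants`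
(`Scaling/IdealStarThreeTermLaw`), the idealised star now carries a floor in the ceiling's own unit `K/(t(1−t))`: the
swap fraction can be pushed neither towards `0` nor towards `1` without paying `1/(t(1−t))`, and only a logarithm
remains open between the two sides.  NOT CLAIMED: the `log K` on this floor (a second-moment argument over `K`
planted units, OPEN-MATH item 2); flow-assisted or rejected swaps; anything measured.  Literature grade (cell rule):
OWN RESULT (first-moment method on a three-valued survival potential); nothing cited as a fact; no new bib keys.
-/

noncomputable section

open Finset Function
open Literature.Probability.MarkovChains

namespace Summit.Ventures.LatticeQCDFlow.Scaling

variable {S : Type*} [Fintype S] [DecidableEq S] {K m : ℕ} {ν : S → ℝ} {M : Fin (K + 1) → S → S → ℝ} {t : ℝ}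

section Floor
variable (κ : Fin m → Fin K)

/-- **A GEOMETRIC SURVIVAL FLOOR ON THE DISTANCE GIVES A FLOOR ON THE MIXING TIME:** if `π` is stationary for the
transition matrix `P`, `d(n) ≥ (1−λ)ⁿ − δ` for all `n` (`0 < λ < 1`) and the chain is `ε`-close at some time, then
**`t_mix(ε) ≥ (1/λ − 1)·log(1/(ε + δ))`** (from `(1−λ)ⁿ ≥ exp(−nλ/(1−λ))`). [ours] -/
theorem mixingTime_ge_of_geom_floor {X : Type*} [Fintype X] [DecidableEq X] {P : X → X → ℝ} (hP : IsRowStochastic P)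
    {π : X → ℝ} (hst : IsStationary π P) {lam δ ε : ℝ} (hlam0 : 0 < lam) (hlam1 : lam < 1)
    (hfloor : ∀ n : ℕ, (1 - lam) ^ n - δ ≤ worstTvDist P π n) (hmix : ∃ t₀, worstTvDist P π t₀ ≤ ε) :
    (1 / lam - 1) * Real.log (1 / (ε + δ)) ≤ (mixingTime P π ε : ℝ) := by
  set n := mixingTime P π ε with hn
  obtain ⟨t₀, ht₀⟩ := hmix
  have hd : worstTvDist P π n ≤ ε := worstTvDist_le_of_mixingTime_le hP hst ht₀ le_rfl
  have hpow : (1 - lam) ^ n ≤ ε + δ := by linarith [(hfloor n).trans hd]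
  have hexp := (one_sub_pow_ge_exp hlam1 n).trans hpow
  have hlog := Real.log_le_log (Real.exp_pos _) hexp
  rw [Real.log_exp] at hlog
  rw [one_div (ε + δ), Real.log_inv]
  have h1l : 0 < 1 - lam := by linarith
  have e : 1 / lam - 1 = (1 - lam) / lam := by field_simp
  rw [e]
  have h3 : (1 - lam) / lam * -Real.log (ε + δ) ≤ (1 - lam) / lam * (n * lam / (1 - lam)) := by
    refine mul_le_mul_of_nonneg_left ?_ (div_nonneg h1l.le hlam0.le)
    linarith
  calc (1 - lam) / lam * -Real.log (ε + δ) ≤ (1 - lam) / lam * (n * lam / (1 - lam)) := h3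
    _ = n * ((1 - lam) / lam * (lam / (1 - lam))) := by ring
    _ = n := by rw [div_mul_div_comm, mul_comm (1 - lam) lam, div_self (mul_ne_zero hlam0.ne' h1l.ne'), mul_one]

/-- **THE UNIT-SURVIVAL DISTANCE FLOOR: `d(n) ≥ (1 − t(1−t)ĉ/m)ⁿ − (K+1)·ν(s)`** for the idealised hot-only star and
EVERY state `s` (`ν` of unit mass; `K ≥ 1` so that a cold level exists). [ours] -/
theorem unitSurvival_worstTvDist_ge (hK : 1 ≤ K) (hm : 1 ≤ m) (ht0 : 0 ≤ t) (ht1 : t ≤ 1) (hν : ∀ v, 0 < ν v)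
    (hν1 : ∑ v, ν v = 1) (hM : ∀ k, IsRowStochastic (M k))
    {cmax : ℕ} (hc : ∀ p' : Fin K, (univ.filter (fun r : Fin m => κ r = p')).card ≤ cmax) (hcm : cmax ≤ m)
    (s : S) (n : ℕ) :
    (1 - t * (1 - t) * cmax / m) ^ n - ((K : ℝ) + 1) * ν s
      ≤ worstTvDist (fun y z : Fin (K + 1) → S => t * ptGraphSwap (fun _ : Fin (K + 1) => ν)
          (fun r : Fin m => (((0 : Fin (K + 1)), (κ r).succ) : Fin (K + 1) × Fin (K + 1))) (fun _ => Equiv.refl S) y z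
        + (1 - t) * prodKernel (fun k : Fin (K + 1) => if k = 0 then (1 : ℝ) else 0) M y z)
        (tensorFun (fun _ : Fin (K + 1) => ν)) n := by
  set Ψ : (Fin (K + 1) → S) → ℝ := fun z => if (∃ k : Fin K, z k.succ = s) then (1 : ℝ) else (if z 0 = s then t else 0)
    with hΨ_def
  have hΨ : ∀ z, Ψ z = if (∃ k : Fin K, z k.succ = s) then (1 : ℝ) else (if z 0 = s then t else 0) := fun _ => rfl
  set P := (fun y z : Fin (K + 1) → S => t * ptGraphSwap (fun _ : Fin (K + 1) => ν)
          (fun r : Fin m => (((0 : Fin (K + 1)), (κ r).succ) : Fin (K + 1) × Fin (K + 1))) (fun _ => Equiv.refl S) y z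
        + (1 - t) * prodKernel (fun k : Fin (K + 1) => if k = 0 then (1 : ℝ) else 0) M y z) with hP_def
  -- the planted start: `s` everywhere (in particular at the cold level `0+1`)
  set x : Fin (K + 1) → S := fun _ => s with hx_def
  have hμ : ∀ (k : Fin (K + 1)) (v : S), 0 < (fun _ : Fin (K + 1) => ν) k v := fun _ v => hν v
  have hμ1 : ∀ k : Fin (K + 1), ∑ v, (fun _ : Fin (K + 1) => ν) k v = 1 := fun _ => hν1
  have hw0 : ∀ k : Fin (K + 1), 0 ≤ (if k = 0 then (1 : ℝ) else 0) := fun k => by split_ifs <;> norm_num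
  have hw1 : ∑ k : Fin (K + 1), (if k = 0 then (1 : ℝ) else 0) = 1 := by
    rw [Finset.sum_ite_eq' univ (0 : Fin (K + 1)), if_pos (mem_univ _)]
  have hPst : IsRowStochastic P := weightedScheme_isRowStochastic (t := t)
    (w := fun k : Fin (K + 1) => if k = 0 then (1 : ℝ) else 0)
    (ptGraphSwap_isRowStochastic (e := fun r : Fin m => (((0 : Fin (K + 1)), (κ r).succ) : Fin (K + 1) × Fin (K + 1)))
      (φ := fun _ => Equiv.refl S) hμ) hM hw0 hw1 ht0 ht1
  have hΨx : Ψ x = 1 := by rw [hΨ, if_pos ⟨⟨0, by omega⟩, rfl⟩]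
  have hmean := scheme_lawAt_survPot_ge κ hm ht0 ht1 hν hM hc hcm s hΨ x n
  rw [hΨx, mul_one] at hmean
  -- `E Ψ ≤ P(∃ k, X_n(k) = s)`
  have hnn : ∀ z, 0 ≤ lawAt P (Pi.single x 1) n z := fun z => lawAt_nonneg hPst (fun a => by
    by_cases ha : a = x
    · subst ha; rw [Pi.single_eq_same]; norm_num
    · rw [Pi.single_eq_of_ne ha]) n z
  have hev : lawMean (lawAt P (Pi.single x 1) n) Ψ
      ≤ ∑ z ∈ univ.filter (fun z : Fin (K + 1) → S => ∃ k ∈ (univ : Finset (Fin (K + 1))), z k = x k),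
          lawAt P (Pi.single x 1) n z := by
    unfold lawMean
    rw [Finset.sum_filter]
    refine sum_le_sum fun z _ => ?_
    have h := mul_le_mul_of_nonneg_left (survPot_le_indicator ht1 s hΨ z) (hnn z)
    calc lawAt P (Pi.single x 1) n z * Ψ z
        ≤ lawAt P (Pi.single x 1) n z
          * (if (∃ k ∈ (univ : Finset (Fin (K + 1))), z k = (fun _ : Fin (K + 1) => s) k) then (1 : ℝ) else 0) := h
      _ = if (∃ k ∈ (univ : Finset (Fin (K + 1))), z k = x k) then lawAt P (Pi.single x 1) n z else 0 := by
          split_ifs <;> ring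
  have hπA := tensorFun_mass_someKept_le hμ hμ1 x (univ : Finset (Fin (K + 1)))
  have hπA' : ∑ z ∈ univ.filter (fun z : Fin (K + 1) → S => ∃ k ∈ (univ : Finset (Fin (K + 1))), z k = x k),
      tensorFun (fun _ : Fin (K + 1) => ν) z ≤ ((K : ℝ) + 1) * ν s := by
    refine hπA.trans (le_of_eq ?_)
    simp only [hx_def, sum_const, card_univ, Fintype.card_fin, nsmul_eq_mul, Nat.cast_add, Nat.cast_one]
  have hmass : ∑ z, lawAt P (Pi.single x 1) n z = ∑ z, tensorFun (fun _ : Fin (K + 1) => ν) z := by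
    rw [sum_lawAt hPst, Finset.sum_pi_single', if_pos (mem_univ _), sum_tensorFun_eq_one _ hμ1]
  have htv := sub_sum_le_tvDist hmass
    (univ.filter (fun z : Fin (K + 1) → S => ∃ k ∈ (univ : Finset (Fin (K + 1))), z k = x k))
  have hw := tvDist_single_le_worstTvDist P (tensorFun (fun _ : Fin (K + 1) => ν)) n x
  linarith

/-- **THE UNIT-SURVIVAL FLOOR ON THE MIXING TIME:** idealised hot-only star, `0 < t < 1`, `ν`-reversible hot kernel,
multiplicities `≤ ĉ` with `1 ≤ ĉ ≤ m`, any state `s`, the scheme `ε`-close at some time: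
**`t_mix(ε) ≥ (m/(t(1−t)ĉ) − 1)·log(1/(ε + (K+1)ν(s)))`** (informative when `ε + (K+1)ν(s) < 1`). [ours] -/
theorem unitSurvival_mixingTime_ge (hK : 1 ≤ K) (hm : 1 ≤ m) (ht0 : 0 < t) (ht1 : t < 1) (hν : ∀ v, 0 < ν v)
    (hν1 : ∑ v, ν v = 1) (hM : ∀ k, IsRowStochastic (M k)) (hMrev : ∀ k, DetailedBalance ν (M k))
    {cmax : ℕ} (hc1 : 1 ≤ cmax) (hc : ∀ p' : Fin K, (univ.filter (fun r : Fin m => κ r = p')).card ≤ cmax)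
    (hcm : cmax ≤ m) (s : S) {ε : ℝ}
    (hmix : ∃ t₀, worstTvDist (fun y z : Fin (K + 1) → S => t * ptGraphSwap (fun _ : Fin (K + 1) => ν)
          (fun r : Fin m => (((0 : Fin (K + 1)), (κ r).succ) : Fin (K + 1) × Fin (K + 1))) (fun _ => Equiv.refl S) y z
        + (1 - t) * prodKernel (fun k : Fin (K + 1) => if k = 0 then (1 : ℝ) else 0) M y z)
        (tensorFun (fun _ : Fin (K + 1) => ν)) t₀ ≤ ε) :
    ((m : ℝ) / (t * (1 - t) * cmax) - 1) * Real.log (1 / (ε + ((K : ℝ) + 1) * ν s))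
      ≤ (mixingTime (fun y z : Fin (K + 1) → S => t * ptGraphSwap (fun _ : Fin (K + 1) => ν)
          (fun r : Fin m => (((0 : Fin (K + 1)), (κ r).succ) : Fin (K + 1) × Fin (K + 1))) (fun _ => Equiv.refl S) y z
        + (1 - t) * prodKernel (fun k : Fin (K + 1) => if k = 0 then (1 : ℝ) else 0) M y z)
        (tensorFun (fun _ : Fin (K + 1) => ν)) ε : ℝ) := by
  have hμ : ∀ (k : Fin (K + 1)) (v : S), 0 < (fun _ : Fin (K + 1) => ν) k v := fun _ v => hν v
  have hw0 : ∀ k : Fin (K + 1), 0 ≤ (if k = 0 then (1 : ℝ) else 0) := fun k => by split_ifs <;> norm_num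
  have hw1 : ∑ k : Fin (K + 1), (if k = 0 then (1 : ℝ) else 0) = 1 := by
    rw [Finset.sum_ite_eq' univ (0 : Fin (K + 1)), if_pos (mem_univ _)]
  have hPst := weightedScheme_isRowStochastic (t := t) (w := fun k : Fin (K + 1) => if k = 0 then (1 : ℝ) else 0)
    (ptGraphSwap_isRowStochastic (e := fun r : Fin m => (((0 : Fin (K + 1)), (κ r).succ) : Fin (K + 1) × Fin (K + 1)))
      (φ := fun _ => Equiv.refl S) hμ) hM hw0 hw1 ht0.le ht1.le
  have hst := (weightedScheme_detailedBalance (w := fun k : Fin (K + 1) => if k = 0 then (1 : ℝ) else 0)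
    (ptGraphSwap_detailedBalance (e := fun r : Fin m => (((0 : Fin (K + 1)), (κ r).succ) : Fin (K + 1) × Fin (K + 1)))
      (φ := fun _ => Equiv.refl S) hμ) (fun k => hMrev k) t).isStationary hPst.2
  have hmpos : (0 : ℝ) < m := Nat.cast_pos.mpr (by omega)
  have hcpos : (0 : ℝ) < cmax := Nat.cast_pos.mpr (by omega)
  have hcm' : (cmax : ℝ) ≤ m := by exact_mod_cast hcm
  have hlam0 : 0 < t * (1 - t) * (cmax : ℝ) / m := div_pos (mul_pos (mul_pos ht0 (by linarith)) hcpos) hmpos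
  have hlam1 : t * (1 - t) * (cmax : ℝ) / m < 1 := by
    rw [div_lt_one hmpos]
    have h1 : t * (1 - t) < 1 := by nlinarith
    have h2 : 0 < t * (1 - t) := mul_pos ht0 (by linarith)
    nlinarith
  have h := mixingTime_ge_of_geom_floor hPst hst hlam0 hlam1
    (fun n => unitSurvival_worstTvDist_ge κ hK hm ht0.le ht1.le hν hν1 hM hc hcm s n) hmix
  have e : (m : ℝ) / (t * (1 - t) * cmax) - 1 = 1 / (t * (1 - t) * (cmax : ℝ) / m) - 1 := by rw [one_div_div]
  rw [e]
  exact h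

/-- **A LARGE CONFIGURATION SPACE SUPPLIES THE RARE VALUE (`|S| ≥ 4(K+1)`):
`t_mix(1/4) ≥ (m/(t(1−t)ĉ) − 1)·log 2`.** [ours] -/
theorem unitSurvival_mixingTime_ge_quarter_of_card (hK : 1 ≤ K) (hS : 4 * (K + 1) ≤ Fintype.card S) (hm : 1 ≤ m)
    (ht0 : 0 < t) (ht1 : t < 1) (hν : ∀ v, 0 < ν v) (hν1 : ∑ v, ν v = 1) (hM : ∀ k, IsRowStochastic (M k))
    (hMrev : ∀ k, DetailedBalance ν (M k)) {cmax : ℕ} (hc1 : 1 ≤ cmax)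
    (hc : ∀ p' : Fin K, (univ.filter (fun r : Fin m => κ r = p')).card ≤ cmax) (hcm : cmax ≤ m)
    (hmix : ∃ t₀, worstTvDist (fun y z : Fin (K + 1) → S => t * ptGraphSwap (fun _ : Fin (K + 1) => ν)
          (fun r : Fin m => (((0 : Fin (K + 1)), (κ r).succ) : Fin (K + 1) × Fin (K + 1))) (fun _ => Equiv.refl S) y z
        + (1 - t) * prodKernel (fun k : Fin (K + 1) => if k = 0 then (1 : ℝ) else 0) M y z)
        (tensorFun (fun _ : Fin (K + 1) => ν)) t₀ ≤ 1 / 4) :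
    ((m : ℝ) / (t * (1 - t) * cmax) - 1) * Real.log 2
      ≤ (mixingTime (fun y z : Fin (K + 1) → S => t * ptGraphSwap (fun _ : Fin (K + 1) => ν)
          (fun r : Fin m => (((0 : Fin (K + 1)), (κ r).succ) : Fin (K + 1) × Fin (K + 1))) (fun _ => Equiv.refl S) y z
        + (1 - t) * prodKernel (fun k : Fin (K + 1) => if k = 0 then (1 : ℝ) else 0) M y z)
        (tensorFun (fun _ : Fin (K + 1) => ν)) (1 / 4) : ℝ) := by
  have hSpos : 0 < Fintype.card S := by omega
  haveI : Nonempty S := Fintype.card_pos_iff.mp hSpos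
  obtain ⟨s, hs⟩ := exists_rare_state (μ := fun _ : Fin (K + 1) => ν) (fun _ => hν1)
  have hcard : (0 : ℝ) < Fintype.card S := Nat.cast_pos.mpr hSpos
  have hS' : 4 * ((K : ℝ) + 1) ≤ Fintype.card S := by exact_mod_cast hS
  have hsum : ∑ _k : Fin (K + 1), ν s = ((K : ℝ) + 1) * ν s := by
    simp only [sum_const, card_univ, Fintype.card_fin, nsmul_eq_mul, Nat.cast_add, Nat.cast_one]
  rw [hsum] at hs
  have hδ : ((K : ℝ) + 1) * ν s ≤ 1 / 4 := hs.trans (by rw [div_le_iff₀ hcard]; linarith)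
  have h := unitSurvival_mixingTime_ge κ hK hm ht0 ht1 hν hν1 hM hMrev hc1 hc hcm s (ε := 1 / 4) hmix
  refine le_trans ?_ h
  have hmpos : (0 : ℝ) < m := Nat.cast_pos.mpr (by omega)
  have hcpos : (0 : ℝ) < cmax := Nat.cast_pos.mpr (by omega)
  have hcm' : (cmax : ℝ) ≤ m := by exact_mod_cast hcm
  have hcoef : 0 ≤ (m : ℝ) / (t * (1 - t) * cmax) - 1 := by
    rw [sub_nonneg, le_div_iff₀ (mul_pos (mul_pos ht0 (by linarith)) hcpos)]
    have h1 : t * (1 - t) ≤ 1 := by nlinarith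
    have h2 : 0 < t * (1 - t) := mul_pos ht0 (by linarith)
    nlinarith
  refine mul_le_mul_of_nonneg_left ?_ hcoef
  have hνs : 0 < ν s := hν s
  have hKν : 0 ≤ ((K : ℝ) + 1) * ν s := mul_nonneg (by positivity) hνs.le
  refine Real.log_le_log (by norm_num) ?_
  rw [le_div_iff₀ (by linarith)]
  linarith

/-- **UNIFORM LISTING (`m = cK`, every multiplicity exactly `c`): `t_mix(1/4) ≥ (K/(t(1−t)) − 1)·log 2`** — the unit
of the ceiling `⌈((K+t)/(t(1−t)))·log(…)⌉` of `Scaling/DominatedStarRetunedConstants`, up to its logarithm. [ours] -/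
theorem uniformStar_unitSurvival_floor (hK : 1 ≤ K) (hS : 4 * (K + 1) ≤ Fintype.card S) (ht0 : 0 < t) (ht1 : t < 1)
    (hν : ∀ v, 0 < ν v) (hν1 : ∑ v, ν v = 1) (hM : ∀ k, IsRowStochastic (M k)) (hMrev : ∀ k, DetailedBalance ν (M k))
    {c : ℕ} (hc1 : 1 ≤ c) (hc : ∀ p' : Fin K, (univ.filter (fun r : Fin m => κ r = p')).card ≤ c) (hmc : m = c * K)
    (hmix : ∃ t₀, worstTvDist (fun y z : Fin (K + 1) → S => t * ptGraphSwap (fun _ : Fin (K + 1) => ν)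
          (fun r : Fin m => (((0 : Fin (K + 1)), (κ r).succ) : Fin (K + 1) × Fin (K + 1))) (fun _ => Equiv.refl S) y z
        + (1 - t) * prodKernel (fun k : Fin (K + 1) => if k = 0 then (1 : ℝ) else 0) M y z)
        (tensorFun (fun _ : Fin (K + 1) => ν)) t₀ ≤ 1 / 4) :
    ((K : ℝ) / (t * (1 - t)) - 1) * Real.log 2
      ≤ (mixingTime (fun y z : Fin (K + 1) → S => t * ptGraphSwap (fun _ : Fin (K + 1) => ν)
          (fun r : Fin m => (((0 : Fin (K + 1)), (κ r).succ) : Fin (K + 1) × Fin (K + 1))) (fun _ => Equiv.refl S) y z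
        + (1 - t) * prodKernel (fun k : Fin (K + 1) => if k = 0 then (1 : ℝ) else 0) M y z)
        (tensorFun (fun _ : Fin (K + 1) => ν)) (1 / 4) : ℝ) := by
  have hm : 1 ≤ m := by rw [hmc]; exact Nat.one_le_iff_ne_zero.mpr (Nat.mul_ne_zero (by omega) (by omega))
  have hcm : c ≤ m := by rw [hmc]; exact Nat.le_mul_of_pos_right c (by omega)
  have h := unitSurvival_mixingTime_ge_quarter_of_card κ hK hS hm ht0 ht1 hν hν1 hM hMrev hc1 hc hcm hmix
  have hcpos : (0 : ℝ) < c := Nat.cast_pos.mpr (by omega)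
  have h1t : 0 < 1 - t := by linarith
  have e : (m : ℝ) / (t * (1 - t) * c) = (K : ℝ) / (t * (1 - t)) := by
    rw [hmc, Nat.cast_mul]
    field_simp
  rwa [e] at h

end Floor

end Summit.Ventures.LatticeQCDFlow.Scaling

end
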